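import Mathlib
import Summits.Ventures.PercRepro2.SwOutMixedArmsBaseHull

/-!
# The several-arms base: the dual base and the blue hull formula (blind cell PercRepro2, night-4
g20, 2026-08-27; proofs/NIGHT4-G20.md §4′)

The DUAL base `dualMixedR σ` keeps the colour of every class edge and flips every other edge; it is
again a `MixedBaseR` for the same data (`MixedBaseR.dual`), and the blue colouring of a realisation
is the realisation of the dual base at the flipped point (`blue_mixedRealR`).  Hence the blue
cluster of `h` at a point without blue-side leak (`LeakBR q = LeakRR (flipPt q)`) is `redSetR`
of the flipped point (`cluster_blue_mixedRealR`), and the hull of `h` at a point without leak lies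
in `{h, u} ∪ {p r} ∪ arms` (`hull_mixedRealR_subset`).  The single-arm twin is
`SwOutMixedBaseDual`.
-/

namespace Summit.Ventures.PercRepro2

namespace MixedArms

open Hull LocRows

variable {V : Type*} {E : Type*}

open scoped Classical

section DualDefs

variable (ends : E → Sym2 V) (u : V) {ι ρ ν κ : Type*} (U : ι → Set V) (p : ρ → V)
  (Ah : ν → Set V) (F : κ → Set V)

/-- The edges of some class. -/
def classAllR : Set E :=
  {e | ∃ j, e ∈ touches ends (U j)} ∪ {e | ∃ i, e ∈ touches ends (Ah i)} ∪
    {e | ∃ r, e ∈ clsUPR ends u p r} ∪ {e | ∃ r, e ∈ clsExtR ends u p Ah r} ∪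
    {e | ∃ k, e ∈ touches ends (F k)}

/-- The dual base: the class edges keep their colour, every other edge is flipped. -/
noncomputable def dualMixedR (σ : Config E) : Config E :=
  fun e => if e ∈ classAllR ends u U p Ah F then σ e else !σ e

variable (arm : ν → ρ)

/-- The blue-side leaks: the red-side leaks of the flipped point. -/
def LeakBR (q : PtR ι ρ ν κ) : Prop := LeakRR arm (flipPt q)

end DualDefs

section Dual

variable {ends : E → Sym2 V} {σ : Config E} {h u : V} {ι ρ ν κ : Type*} {U : ι → Set V}
  {p : ρ → V} {Ah : ν → Set V} {arm : ν → ρ} {F : κ → Set V}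
  (hb : MixedBaseR ends σ h u U p Ah arm F)
include hb

omit hb in
/-- The dual base on a class edge. -/
lemma dualMixedR_apply_of_mem {e : E} (he : e ∈ classAllR ends u U p Ah F) :
    dualMixedR ends u U p Ah F σ e = σ e := by
  simp [dualMixedR, he]

omit hb in
/-- The dual base off the classes. -/
lemma dualMixedR_apply_of_notMem {e : E} (he : e ∉ classAllR ends u U p Ah F) :
    dualMixedR ends u U p Ah F σ e = !σ e := by
  simp [dualMixedR, he]

/-- An edge at `h` is a class edge. -/
lemma MixedBaseR.h_edge_mem_classAllR {e : E} {x : V} (he : ends e = s(h, x)) :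
    e ∈ classAllR ends u U p Ah F := by
  rcases hb.h_edges e x he with ⟨j, hj⟩ | ⟨i, hi⟩ | ⟨k, hk⟩
  · exact Or.inl (Or.inl (Or.inl (Or.inl ⟨j, x, hj, h, ends_swap he⟩)))
  · exact Or.inl (Or.inl (Or.inl (Or.inr ⟨i, x, hi, h, ends_swap he⟩)))
  · exact Or.inr ⟨k, x, hk, h, ends_swap he⟩

/-- An edge at `u` is a class edge. -/
lemma MixedBaseR.u_edge_mem_classAllR {e : E} {x : V} (he : ends e = s(u, x)) :
    e ∈ classAllR ends u U p Ah F := by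
  rcases hb.u_edges e x he with ⟨j, hj⟩ | ⟨r, rfl⟩
  · exact Or.inl (Or.inl (Or.inl (Or.inl ⟨j, x, hj, u, ends_swap he⟩)))
  · exact Or.inl (Or.inl (Or.inr ⟨r, he⟩))

/-- An edge at a dropped vertex is a class edge. -/
lemma MixedBaseR.p_edge_mem_classAllR {r : ρ} {e : E} {x : V} (he : ends e = s(p r, x)) :
    e ∈ classAllR ends u U p Ah F := by
  rcases hb.p_edges r e x he with rfl | ⟨i, -, hx⟩ | ⟨_, _, hx⟩
  · exact Or.inl (Or.inl (Or.inr ⟨r, ends_swap he⟩))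
  · exact Or.inl (Or.inl (Or.inl (Or.inr ⟨i, x, hx, p r, ends_swap he⟩)))
  · by_cases hxu : x = u
    · subst hxu
      exact Or.inl (Or.inl (Or.inr ⟨r, ends_swap he⟩))
    · exact Or.inl (Or.inr ⟨r, x, he, hxu, fun i hxA =>
        hx (Or.inl (Or.inr (Set.mem_iUnion.2 ⟨i, hxA⟩)))⟩)

omit hb in
/-- An edge with an end in an arm is a class edge. -/
lemma MixedBaseR.arm_edge_mem_classAllR {e : E} {x y : V} (he : ends e = s(x, y))
    (hx : x ∈ armsAllR U Ah F) : e ∈ classAllR ends u U p Ah F := by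
  rcases hx with (hx | hx) | hx
  · obtain ⟨j, hj⟩ := Set.mem_iUnion.1 hx
    exact Or.inl (Or.inl (Or.inl (Or.inl ⟨j, x, hj, y, he⟩)))
  · obtain ⟨i, hi⟩ := Set.mem_iUnion.1 hx
    exact Or.inl (Or.inl (Or.inl (Or.inr ⟨i, x, hi, y, he⟩)))
  · obtain ⟨k, hk⟩ := Set.mem_iUnion.1 hx
    exact Or.inr ⟨k, x, hk, y, he⟩

/-- The dual base agrees with the base inside `S ∪ {h}` for an arm `S`. -/
lemma MixedBaseR.insideConfig_dualMixedR (S : Set V) (hS : S ⊆ armsAllR U Ah F) :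
    insideConfig ends (S ∪ {h}) (dualMixedR ends u U p Ah F σ) =
      insideConfig ends (S ∪ {h}) σ := by
  funext e
  simp only [insideConfig]
  by_cases hw : e ∈ within ends (S ∪ {h})
  · obtain ⟨x, hx, y, hy, hxy⟩ := hw
    have hc : e ∈ classAllR ends u U p Ah F := by
      rcases hx with hx | hx
      · exact MixedBaseR.arm_edge_mem_classAllR hxy (hS hx)
      · rw [Set.mem_singleton_iff] at hx
        subst hx
        exact hb.h_edge_mem_classAllR hxy
    rw [dualMixedR_apply_of_mem hc]
  · rw [decide_eq_false hw]
    simp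

/-- **The dual base is a several-arms base.** -/
theorem MixedBaseR.dual : MixedBaseR ends (dualMixedR ends u U p Ah F σ) h u U p Ah arm F where
  hne_hu := hb.hne_hu
  hne_hp := hb.hne_hp
  hne_up := hb.hne_up
  p_inj := hb.p_inj
  h_notMem_U := hb.h_notMem_U
  u_notMem_U := hb.u_notMem_U
  p_notMem_U := hb.p_notMem_U
  h_notMem_Ah := hb.h_notMem_Ah
  u_notMem_Ah := hb.u_notMem_Ah
  p_notMem_Ah := hb.p_notMem_Ah
  h_notMem_F := hb.h_notMem_F
  u_notMem_F := hb.u_notMem_F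
  p_notMem_F := hb.p_notMem_F
  U_disj := hb.U_disj
  U_disj_Ah := hb.U_disj_Ah
  U_disj_F := hb.U_disj_F
  Ah_disj := hb.Ah_disj
  Ah_disj_F := hb.Ah_disj_F
  F_disj := hb.F_disj
  U_nonempty := hb.U_nonempty
  Ah_nonempty := hb.Ah_nonempty
  F_nonempty := hb.F_nonempty
  no_cross_UU := hb.no_cross_UU
  no_cross_UAh := hb.no_cross_UAh
  no_cross_UF := hb.no_cross_UF
  no_cross_AhAh := hb.no_cross_AhAh
  no_cross_AhF := hb.no_cross_AhF
  no_cross_FF := hb.no_cross_FF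
  h_edges := hb.h_edges
  u_edges := hb.u_edges
  p_edges := hb.p_edges
  u_adj_U := hb.u_adj_U
  h_red := fun e x he => by
    rw [dualMixedR_apply_of_mem (hb.h_edge_mem_classAllR he)]
    exact hb.h_red e x he
  u_red := fun e x he => by
    rw [dualMixedR_apply_of_mem (hb.u_edge_mem_classAllR he)]
    exact hb.u_red e x he
  dead_blue := fun r e x he hx => by
    rw [dualMixedR_apply_of_mem (hb.p_edge_mem_classAllR he)]
    exact hb.dead_blue r e x he hx
  ext_blue := fun r e x he hxu hxA => by
    rw [dualMixedR_apply_of_mem (hb.p_edge_mem_classAllR he)]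
    exact hb.ext_blue r e x he hxu hxA
  bdry_blue := fun e x y he hx hyh hyu hyp hy => by
    rw [dualMixedR_apply_of_mem (MixedBaseR.arm_edge_mem_classAllR he hx)]
    exact hb.bdry_blue e x y he hx hyh hyu hyp hy
  U_conn := fun j x hx => by
    rw [hb.insideConfig_dualMixedR (U j)
      (fun y hy => Or.inl (Or.inl (Set.mem_iUnion.2 ⟨j, hy⟩)))]
    exact hb.U_conn j x hx
  Ah_conn := fun i x hx => by
    rw [hb.insideConfig_dualMixedR (Ah i)
      (fun y hy => Or.inl (Or.inr (Set.mem_iUnion.2 ⟨i, hy⟩)))]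
    exact hb.Ah_conn i x hx
  F_conn := fun k x hx => by
    rw [hb.insideConfig_dualMixedR (F k) (fun y hy => Or.inr (Set.mem_iUnion.2 ⟨k, hy⟩))]
    exact hb.F_conn k x hx

/-- **The blue colouring of a realisation is the realisation of the dual base at the flipped
point.** -/
theorem MixedBaseR.blue_mixedRealR (q : PtR ι ρ ν κ) :
    blue (mixedRealR ends u U p Ah F σ q) =
      mixedRealR ends u U p Ah F (dualMixedR ends u U p Ah F σ) (flipPt q) := by
  funext e
  simp only [blue]
  by_cases hU : ∃ j, e ∈ touches ends (U j)
  · obtain ⟨j, hj⟩ := hU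
    rw [hb.mixedRealR_apply_U hj, hb.dual.mixedRealR_apply_U hj,
      dualMixedR_apply_of_mem (Or.inl (Or.inl (Or.inl (Or.inl ⟨j, hj⟩))))]
    simp only [flipPt, flipAll]
    by_cases hj' : q.1 j = true <;> simp [hj']
  by_cases hA : ∃ i, e ∈ touches ends (Ah i)
  · obtain ⟨i, hi⟩ := hA
    rw [hb.mixedRealR_apply_Ah hi, hb.dual.mixedRealR_apply_Ah hi,
      dualMixedR_apply_of_mem (Or.inl (Or.inl (Or.inl (Or.inr ⟨i, hi⟩))))]
    simp only [flipPt, flipAll]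
    by_cases hi' : q.2.1 i = true <;> simp [hi']
  by_cases hUP : ∃ r, e ∈ clsUPR ends u p r
  · obtain ⟨r, hr⟩ := hUP
    rw [hb.mixedRealR_apply_UP hr, hb.dual.mixedRealR_apply_UP hr,
      dualMixedR_apply_of_mem (Or.inl (Or.inl (Or.inr ⟨r, hr⟩)))]
    simp only [flipPt]
    by_cases hc' : q.2.2.1 r = true <;> simp [hc']
  by_cases hX : ∃ r, e ∈ clsExtR ends u p Ah r
  · obtain ⟨r, hr⟩ := hX
    rw [hb.mixedRealR_apply_Ext hr, hb.dual.mixedRealR_apply_Ext hr,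
      dualMixedR_apply_of_mem (Or.inl (Or.inr ⟨r, hr⟩))]
    simp only [flipPt]
    by_cases hc' : q.2.2.2.1 r = true <;> simp [hc']
  by_cases hF : ∃ k, e ∈ touches ends (F k)
  · obtain ⟨k, hk⟩ := hF
    rw [hb.mixedRealR_apply_F hk, hb.dual.mixedRealR_apply_F hk,
      dualMixedR_apply_of_mem (Or.inr ⟨k, hk⟩)]
    simp only [flipPt, flipAll]
    by_cases hk' : q.2.2.2.2 k = true <;> simp [hk']
  · simp only [not_exists] at hU hA hUP hX hF
    have hc : e ∉ classAllR ends u U p Ah F := by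
      rintro ((((⟨j, hj⟩ | ⟨i, hi⟩) | ⟨r, hr⟩) | ⟨r, hr⟩) | ⟨k, hk⟩)
      · exact hU j hj
      · exact hA i hi
      · exact hUP r hr
      · exact hX r hr
      · exact hF k hk
    rw [MixedBaseR.mixedRealR_apply_none hU hA hUP hX hF,
      MixedBaseR.mixedRealR_apply_none hU hA hUP hX hF, dualMixedR_apply_of_notMem hc]

/-- **The blue hull formula**: at a point without blue-side leak, the blue cluster of `h` is
`redSetR` of the flipped point. -/
theorem MixedBaseR.cluster_blue_mixedRealR (hup : ∀ r, ∃ e, ends e = s(u, p r))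
    {q : PtR ι ρ ν κ} (hq : ¬ LeakBR arm q) :
    cluster ends (blue (mixedRealR ends u U p Ah F σ q)) h = redSetR h u U p Ah F (flipPt q) := by
  rw [hb.blue_mixedRealR]
  exact hb.dual.cluster_mixedRealR hup hq

omit hb in
/-- `redSetR` lies in `{h, u}` with the dropped vertices and the arms. -/
lemma redSetR_subset {q : PtR ι ρ ν κ} {x : V} (hx : x ∈ redSetR h u U p Ah F q) :
    x ∈ {h} ∪ {u} ∪ Set.range p ∪ armsAllR U Ah F := by
  rw [mem_redSetR_iff] at hx
  rcases hx with rfl | ⟨j, _, hx⟩ | ⟨rfl, _⟩ | ⟨r, rfl, _⟩ | ⟨i, _, hx⟩ | ⟨k, _, hx⟩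
  · exact Or.inl (Or.inl (Or.inl rfl))
  · exact Or.inr (Or.inl (Or.inl (Set.mem_iUnion.2 ⟨j, hx⟩)))
  · exact Or.inl (Or.inl (Or.inr rfl))
  · exact Or.inl (Or.inr ⟨r, rfl⟩)
  · exact Or.inr (Or.inl (Or.inr (Set.mem_iUnion.2 ⟨i, hx⟩)))
  · exact Or.inr (Or.inr (Set.mem_iUnion.2 ⟨k, hx⟩))

/-- **The hull of `h` at a point without leak lies in `{h, u}` with the dropped vertices and the
arms.** -/
theorem MixedBaseR.hull_mixedRealR_subset (hup : ∀ r, ∃ e, ends e = s(u, p r))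
    {q : PtR ι ρ ν κ} (hqR : ¬ LeakRR arm q) (hqB : ¬ LeakBR arm q) :
    hull ends (mixedRealR ends u U p Ah F σ q) h ⊆ {h} ∪ {u} ∪ Set.range p ∪ armsAllR U Ah F := by
  intro x hx
  rcases hx with hx | hx
  · rw [hb.cluster_mixedRealR hup hqR] at hx
    exact redSetR_subset hx
  · rw [hb.cluster_blue_mixedRealR hup hqB] at hx
    exact redSetR_subset hx

end Dual

end MixedArms

end Summit.Ventures.PercRepro2
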